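import Summits.RiemannHypothesis.RiemannHypothesis.Theorems.Splittings.RobinFiniteE3Window
import HarnessLib

/-!
# Splittings — Robin finite lens, E3 (the CA Mertens certificate re-read with window hypotheses), part 2/6, §B

Cell rh-split, seat rh-split-robin-finite g7 (brief sha16 f79c5f09d8bcb036), card `run/shared/lean/pub/rh-split/cards/SPLIT-robin-finite.md` §14
(referee rh-split-ref g3 REFEREE ADDENDUM (robin, finite) §14 DELIVERABLE + REPLAY ×2 2026-08-27T05:39:31Z; lead rh-split-lead g3 RULING #24:
zero-def variant of record); cut of `HOME/rh-split-robin-finite/SketchG7-E3-zerodef.lean` (sha16 c3a3285c0daab218, 1644 l, 52 thms, ZERO defs —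
generated by the seat from SketchG7-E3.lean deb49c670b0d4cda by spelling out `ThetaWindow` / `EBoxOn` / `Eb` / `budgetPT`) into SIX files
(`RobinFiniteE3Window` §A, `…Combine` §B, `…Cells` §C, `…Large` §D, `…Error` §E, `…Main` §F; the card's five-file plan puts §A+§B in one
file, which is 428 l > the 400-line rule), filed by rh-split-typer-1 g4.  Decl blocks byte-identical to the scratch; one namespace
`…Theorems.Splittings.RobinFiniteE3` (scratch: `…Splittings.RobinFinite.E3Z`).

This part — part 2/6, §B: the three combination lemmas with an ABSTRACT error value `E` (`cell_keyW`, `small_Q_keyW`, `large_Q_keyW`).  RH-free.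

E3 of the card's exchange lemma = the MECHANICAL RE-READ of the tree's CA Mertens certificate `RobinAnalyticSharp.mertens_prod_lt_RH`
with its two RH uses replaced: (θ) Schoenfeld's `|θ t − t| ≤ √t log² t/(8π)` by a WINDOW hypothesis `∀ y ∈ [599, B], |θ y − y| ≤ √y log² y/(8π)`
(spelled out), and (f) Nicolas's `−log f(P) ≤ E_RH(P)` by an ABSTRACT error value / function, so that the tree's RH-free inputs
`RobinFiniteE1c.schoenfeldThetaOn_of_buthe2016` and `RobinFiniteTail(Free).nicolasLowerBetween_PT_tailFree` plug in (in `…Main`).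
No new analytic idea: every proof is the tree's, with `hS hRH` ↦ `hW … (t ≤ B)` and `nicolasERH_mul_le` ↦ a hypothesis.
HONEST LABEL: «SPLITTING SEARCH over kernel-typed RH-EQUIVALENCES; a splitting A ∧ B ⟹ RH is CONDITIONAL bookkeeping
unless A and B are both proved; nothing here bears on the truth of RH.»  Referee labels: class (robin, finite) UNCHANGED (RELABELLING ×4,
tail-rigid); the conditional headline's modulo-list is PRINT-ONLY {Buthe2016_thm2, Buthe2018_thm2_theta, BroadbentEtAl2021_theta_rel_1e19, RH(H₀)}.
-/

set_option linter.dupNamespace false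

noncomputable section

open Real Filter Finset
open scoped Chebyshev

namespace Summit.RiemannHypothesis.RiemannHypothesis.Theorems.Splittings.RobinFiniteE3

open Literature.NumberTheory.LFunctions
open RobinAnalyticSharp

/-! ## §B · The three combination lemmas with an ABSTRACT error value `E`

`cell_keyRH` / `small_Q_keyRH` / `large_Q_keyRH` conclude `nicolasERH P < G₂ + G₁` from `nicolasERH_mul_le` (the box
bound) and the cell inequality; here the error is an arbitrary real `E` with the hypothesis `E·√P·log P < boxes`. -/

/-- `cell_key` with an abstract error value. -/
theorem cell_keyW {B : ℝ} (hW : (∀ y : ℝ, 599 ≤ y → y ≤ B → |θ y - y| ≤ √y * Real.log y ^ 2 / (8 * π))) {P Q : ℕ} {E P₁ a₁ a₂ d₁ dP ℓ₁ L₁ s₁ mlow cR : ℝ}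
    (hQ : 599 ≤ Q) (hQP : Q ≤ P) (hPB : (P : ℝ) ≤ B) (hP₁ : 599 ≤ P₁) (hPl : P₁ ≤ P)
    (ha₁ : a₁ * √(P : ℝ) ≤ Q) (ha₂ : (Q : ℝ) ≤ a₂ * √(P : ℝ)) (ha₁0 : 0 ≤ a₁) (ha₂0 : 0 < a₂)
    (hd₁ : schoenfeldDelta (max 599 (a₁ * √P₁)) ≤ d₁) (hd₁1 : d₁ ≤ 1 / 2)
    (hdP : schoenfeldDelta P₁ ≤ dP)
    (hℓ₁ : ℓ₁ ≤ Real.log (max 599 (a₁ * √P₁))) (hℓ₁0 : 0 < ℓ₁)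
    (hL₁ : L₁ ≤ Real.log P₁) (hL₁0 : 0 < L₁)
    (hs₁ : s₁ ≤ √P₁) (hs₁0 : 0 < s₁)
    (hm0 : 0 ≤ mlow) (hm : ∀ L : ℝ, L₁ ≤ L → mlow * (a₂ * (Real.log a₂ + L / 2)) ≤ L)
    (hcR : (1 + dP) + (1 + d₁) * a₂ / s₁ ≤ cR)
    (hκ : 0 ≤ (1 - d₁) * (ℓ₁ / (ℓ₁ + 1)) - 2 * d₁)
    (hE : E * (√(P : ℝ) * Real.log P) < g1Box d₁ a₁ cR L₁ + g2Box d₁ ℓ₁ mlow s₁) :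
    E <
      ∑ p ∈ (Nat.primesLE P).filter (fun p => Q < p), ((p : ℝ) ^ 2)⁻¹ +
        θ Q / ((θ P + θ Q) * Real.log (θ P + θ Q)) := by
  have hP599 : (599 : ℝ) ≤ P := by
    have : (599 : ℝ) ≤ Q := by exact_mod_cast hQ
    exact this.trans (by exact_mod_cast hQP)
  have hP0 : (0 : ℝ) < P := by linarith
  have hsL : 0 < √(P : ℝ) * Real.log P :=
    mul_pos (Real.sqrt_pos.2 hP0) (Real.log_pos (by linarith))
  have hG2 := G2_mul_geW hW hQ hQP hPB hPl hP₁ ha₁ ha₂ ha₁0 ha₂0 hd₁ hd₁1 hℓ₁ hℓ₁0 hL₁ hs₁ hs₁0 hm0 hm hκ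
  have hG1 := G1_mul_geW hW hQ hQP hPB hPl hP₁ ha₁ ha₂ ha₁0 ha₂0 hd₁ hd₁1 hdP hL₁ hL₁0 hs₁ hs₁0 hcR
  have h : E * (√(P : ℝ) * Real.log P) <
      (∑ p ∈ (Nat.primesLE P).filter (fun p => Q < p), ((p : ℝ) ^ 2)⁻¹ +
        θ Q / ((θ P + θ Q) * Real.log (θ P + θ Q))) * (√(P : ℝ) * Real.log P) := by
    rw [add_mul]; linarith
  exact lt_of_mul_lt_mul_right h hsL.le

/-- `small_Q_key` with an abstract error value (`Q ≤ 599`: the cell `[0, a₂√P]` at `Q' = 599`, `G₁ ≥ 0`). -/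
theorem small_Q_keyW {B : ℝ} (hW : (∀ y : ℝ, 599 ≤ y → y ≤ B → |θ y - y| ≤ √y * Real.log y ^ 2 / (8 * π))) {P Q : ℕ} {E P₁ a₂ d₁ ℓ₁ L₁ s₁ mlow : ℝ}
    (hQ : Q ≤ 599) (h599P : 599 ≤ P) (hPB : (P : ℝ) ≤ B) (hP₁ : 599 ≤ P₁) (hPl : P₁ ≤ P)
    (ha₂ : (599 : ℝ) ≤ a₂ * √(P : ℝ)) (ha₂0 : 0 < a₂)
    (hd₁ : schoenfeldDelta 599 ≤ d₁) (hd₁1 : d₁ ≤ 1 / 2)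
    (hℓ₁ : ℓ₁ ≤ Real.log 599) (hℓ₁0 : 0 < ℓ₁)
    (hL₁ : L₁ ≤ Real.log P₁)
    (hs₁ : s₁ ≤ √P₁) (hs₁0 : 0 < s₁)
    (hm0 : 0 ≤ mlow) (hm : ∀ L : ℝ, L₁ ≤ L → mlow * (a₂ * (Real.log a₂ + L / 2)) ≤ L)
    (hκ : 0 ≤ (1 - d₁) * (ℓ₁ / (ℓ₁ + 1)) - 2 * d₁)
    (hE : E * (√(P : ℝ) * Real.log P) < g2Box d₁ ℓ₁ mlow s₁) :
    E <
      ∑ p ∈ (Nat.primesLE P).filter (fun p => Q < p), ((p : ℝ) ^ 2)⁻¹ +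
        θ Q / ((θ P + θ Q) * Real.log (θ P + θ Q)) := by
  have hP599 : (599 : ℝ) ≤ P := by exact_mod_cast h599P
  have hP0 : (0 : ℝ) < P := by linarith
  have hsL : 0 < √(P : ℝ) * Real.log P :=
    mul_pos (Real.sqrt_pos.2 hP0) (Real.log_pos (by linarith))
  have hmax : max (599 : ℝ) (0 * √P₁) = 599 := by simp
  have hG2 := G2_mul_geW hW (Q := 599) (P := P) le_rfl h599P hPB hPl hP₁ (a₁ := 0) (a₂ := a₂)
    (by simp) (by exact_mod_cast ha₂) le_rfl ha₂0 (by rwa [hmax]) hd₁1 (by rwa [hmax]) hℓ₁0 hL₁ hs₁ hs₁0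
    hm0 hm hκ
  have hS' := sum_filter_antitone (P := P) hQ
  have hG0 : 0 ≤ θ Q / ((θ P + θ Q) * Real.log (θ P + θ Q)) := by
    have h1 : 0 ≤ θ (Q : ℝ) := Chebyshev.theta_nonneg _
    have h2 : 1 ≤ θ (P : ℝ) := by
      obtain ⟨hl, -⟩ := theta_two_sidedW hW hP599 le_rfl hPB
      have hδ := schoenfeldDelta_le hP599
      have : (1 - 0.0666) * 599 ≤ (1 - schoenfeldDelta P) * (P : ℝ) :=
        mul_le_mul (by linarith) hP599 (by norm_num) (by linarith [schoenfeldDelta_nonneg (P : ℝ)])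
      linarith
    have h3 : 0 ≤ Real.log (θ P + θ Q) := Real.log_nonneg (by linarith)
    positivity
  have h : E * (√(P : ℝ) * Real.log P) <
      (∑ p ∈ (Nat.primesLE P).filter (fun p => 599 < p), ((p : ℝ) ^ 2)⁻¹) * (√(P : ℝ) * Real.log P) := by
    linarith
  have h' := lt_of_mul_lt_mul_right h hsL.le
  linarith

/-- `large_Q_key` with an abstract error value (proof verbatim, window `θ`). -/
theorem large_Q_keyW {B : ℝ} (hW : (∀ y : ℝ, 599 ≤ y → y ≤ B → |θ y - y| ≤ √y * Real.log y ^ 2 / (8 * π))) {P Q : ℕ}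
    {E P₁ a d₁ dP L₁ c : ℝ}
    (hQ : 599 ≤ Q) (hQP : Q ≤ P) (hPB : (P : ℝ) ≤ B) (hP₁ : 599 ≤ P₁) (hPl : P₁ ≤ P)
    (ha : a * √(P : ℝ) ≤ Q) (ha0 : 0 ≤ a)
    (hd₁ : schoenfeldDelta (max 599 (a * √P₁)) ≤ d₁) (hd₁1 : d₁ ≤ 1 / 2)
    (hdP : schoenfeldDelta P₁ ≤ dP)
    (hL₁ : L₁ ≤ Real.log P₁) (hL₁0 : 0 < L₁)
    (hc : 2 + dP + d₁ ≤ c)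
    (hE : E * (√(P : ℝ) * Real.log P) < (1 - d₁) * a / (c * (1 + (c - 1) / L₁))) :
    E <
      ∑ p ∈ (Nat.primesLE P).filter (fun p => Q < p), ((p : ℝ) ^ 2)⁻¹ +
        θ Q / ((θ P + θ Q) * Real.log (θ P + θ Q)) := by
  have hQr : (599 : ℝ) ≤ Q := by exact_mod_cast hQ
  have hQPr : (Q : ℝ) ≤ P := by exact_mod_cast hQP
  have hP599 : (599 : ℝ) ≤ P := hQr.trans hQPr
  have hP0 : (0 : ℝ) < P := by linarith
  have hP₁0 : 0 < P₁ := by linarith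
  have hQ0 : (0 : ℝ) < Q := by linarith
  set L := Real.log (P : ℝ) with hL
  set s := √(P : ℝ) with hs
  have hs0 : 0 < s := Real.sqrt_pos.2 hP0
  have hss : s * s = P := Real.mul_self_sqrt hP0.le
  have hLpos : 0 < L := Real.log_pos (by linarith)
  have hLl : L₁ ≤ L := hL₁.trans (Real.log_le_log hP₁0 hPl)
  have hsL : 0 < s * L := mul_pos hs0 hLpos
  have hS0 : 0 ≤ ∑ p ∈ (Nat.primesLE P).filter (fun p => Q < p), ((p : ℝ) ^ 2)⁻¹ :=
    Finset.sum_nonneg fun p _ => by positivity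
  -- θ bounds and `G₁ ≥ (1−δQ)Q/(R₁ log R₁)`
  set δQ := schoenfeldDelta Q with hδQ
  set δP := schoenfeldDelta P with hδP
  obtain ⟨hθQl, hθQu⟩ := theta_two_sidedW hW hQr le_rfl (hQPr.trans hPB)
  obtain ⟨hθPl, hθPu⟩ := theta_two_sidedW hW hP599 le_rfl hPB
  rw [← hδQ] at hθQl hθQu
  rw [← hδP] at hθPl hθPu
  have hmaxQ : max 599 (a * √P₁) ≤ Q := by
    refine max_le hQr (le_trans ?_ ha)
    exact mul_le_mul_of_nonneg_left (Real.sqrt_le_sqrt hPl) ha0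
  have hδQd : δQ ≤ d₁ := (schoenfeldDelta_antitone (le_max_left _ _) hmaxQ).trans hd₁
  have hδQ0 : 0 ≤ δQ := schoenfeldDelta_nonneg _
  have hδPd : δP ≤ dP := (schoenfeldDelta_antitone hP₁ hPl).trans hdP
  have hδP0 : 0 ≤ δP := schoenfeldDelta_nonneg _
  have hδP1 : δP ≤ 0.0666 := schoenfeldDelta_le hP599
  have hd₁0 : 0 ≤ d₁ := hδQ0.trans hδQd
  set R₁ := (1 + δP) * P + (1 + δQ) * Q with hR₁
  have hθP1 : 1 ≤ θ P := by
    have : (1 - 0.0666) * 599 ≤ (1 - δP) * (P : ℝ) :=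
      mul_le_mul (by linarith) hP599 (by norm_num) (by linarith)
    linarith
  have hlow : 0 ≤ (1 - δQ) * Q := mul_nonneg (by linarith) hQ0.le
  have hG := G1_lower hθP1 (Chebyshev.theta_nonneg _) hθQl hlow (by linarith : θ P + θ Q ≤ R₁)
  -- `R₁ ≤ c P`, `R₁ log R₁ ≤ cP (L + c − 1)`
  have hc1 : 2 ≤ c := by linarith
  have hR₁le : R₁ ≤ c * P := by
    have h1 : (1 + δQ) * (Q : ℝ) ≤ (1 + d₁) * P := mul_le_mul (by linarith) hQPr hQ0.le (by linarith)
    have h2 : (1 + δP) * (P : ℝ) ≤ (1 + dP) * P := mul_le_mul_of_nonneg_right (by linarith) hP0.le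
    have h3 : (1 + dP) * (P : ℝ) + (1 + d₁) * P ≤ c * P := by nlinarith
    simp only [hR₁]; linarith
  have hPδ : (P : ℝ) ≤ (1 + δP) * P := by
    have := mul_nonneg hδP0 hP0.le
    linarith [show (1 + δP) * (P : ℝ) = P + δP * P by ring]
  have hQδ : 0 ≤ (1 + δQ) * (Q : ℝ) := by positivity
  have hR₁1 : 1 < R₁ := by simp only [hR₁]; linarith
  have hden0 : 0 < R₁ * Real.log R₁ := mul_pos (by linarith) (Real.log_pos hR₁1)
  have hlogR : R₁ * Real.log R₁ ≤ (c * P) * (L + (c - 1)) := by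
    have h1 := mul_log_mono hR₁1.le hR₁le
    have h2 : Real.log (c * P) ≤ L + (c - 1) := by
      rw [Real.log_mul (by positivity) hP0.ne']
      linarith [Real.log_le_sub_one_of_pos (by positivity : 0 < c)]
    exact h1.trans (mul_le_mul_of_nonneg_left h2 (by positivity))
  have hnum : (1 - d₁) * (a * s) ≤ (1 - δQ) * Q := mul_le_mul (by linarith) ha (by positivity) (by linarith)
  have hG2 : (1 - d₁) * (a * s) / ((c * P) * (L + (c - 1))) ≤ (1 - δQ) * Q / (R₁ * Real.log R₁) := by
    calc (1 - d₁) * (a * s) / ((c * P) * (L + (c - 1)))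
        ≤ (1 - d₁) * (a * s) / (R₁ * Real.log R₁) :=
          div_le_div_of_nonneg_left (mul_nonneg (by linarith) (by positivity)) hden0 hlogR
      _ ≤ (1 - δQ) * Q / (R₁ * Real.log R₁) := div_le_div_of_nonneg_right hnum hden0.le
  have e : (1 - d₁) * (a * s) / ((c * P) * (L + (c - 1))) * (s * L) =
      (1 - d₁) * a / (c * (1 + (c - 1) / L)) := by
    rw [← hss]; field_simp
  have hbox : (1 - d₁) * a / (c * (1 + (c - 1) / L₁)) ≤ (1 - d₁) * a / (c * (1 + (c - 1) / L)) := by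
    apply div_le_div_of_nonneg_left (mul_nonneg (by linarith) ha0) (by
      have : 0 ≤ (c - 1) / L := by apply div_nonneg <;> linarith
      positivity)
    apply mul_le_mul_of_nonneg_left _ (by linarith)
    have : (c - 1) / L ≤ (c - 1) / L₁ := div_le_div_of_nonneg_left (by linarith) hL₁0 hLl
    linarith
  have hG1 : (1 - d₁) * a / (c * (1 + (c - 1) / L₁)) ≤
      θ Q / ((θ P + θ Q) * Real.log (θ P + θ Q)) * (s * L) := by
    calc (1 - d₁) * a / (c * (1 + (c - 1) / L₁)) ≤ (1 - d₁) * a / (c * (1 + (c - 1) / L)) := hbox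
      _ = (1 - d₁) * (a * s) / ((c * P) * (L + (c - 1))) * (s * L) := e.symm
      _ ≤ (1 - δQ) * Q / (R₁ * Real.log R₁) * (s * L) := mul_le_mul_of_nonneg_right hG2 hsL.le
      _ ≤ θ Q / ((θ P + θ Q) * Real.log (θ P + θ Q)) * (s * L) := mul_le_mul_of_nonneg_right hG hsL.le
  have h : E * (s * L) <
      (∑ p ∈ (Nat.primesLE P).filter (fun p => Q < p), ((p : ℝ) ^ 2)⁻¹ +
        θ Q / ((θ P + θ Q) * Real.log (θ P + θ Q))) * (s * L) := by
    rw [add_mul]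
    have : 0 ≤ (∑ p ∈ (Nat.primesLE P).filter (fun p => Q < p), ((p : ℝ) ^ 2)⁻¹) * (s * L) :=
      mul_nonneg hS0 hsL.le
    linarith
  exact lt_of_mul_lt_mul_right h hsL.le

end Summit.RiemannHypothesis.RiemannHypothesis.Theorems.Splittings.RobinFiniteE3

end
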